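/-
Copyright: the b2b-balaban cell (near-miss cell 7), T⁴-continuum fan-out; row NE7b CRUX team (2), seat
t4-ne7b-formalise-leaf-02 (gen 24; the row owner's INTERFACE REQUEST NE7b IR-41-5 «S12-W», leaf-02 part (E1) of
`CLAIMS.log` l.27398).  Released under the licence of the surrounding project.
-/
import Summits.QuantumFields.BalabanUV.T4Continuum.Support.HistoryRealiseWeakReading

/-!
# History assembly, per-run S-profile: THE R7-a END RE-PLUGGED OVER THE MEMORY-AGNOSTIC READING `RealisedReadingRW`
(INTERFACE REQUEST NE7b IR-41-5 «S12-W», leaf-02 part, file E1 of 3; repair route R-41-a of R-OWNER-41-1)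

Summits-side support leaf of the T⁴-continuum cell (rung (B)+1 on a FINITE torus only; NOT infinite volume, NOT the
mass gap, NOT the Clay statement; NOT a proof of the spine estimate NE7b, which is the cell's OWN estimate, NOT PRINTED
and NOT PROVED).  Row NE7b, route «COUNT» ∕ R-P1; the row owner's INTERFACE REQUEST NE7b IR-41-5 (`HOME/INBOX.md` block
«from b2b-balaban-t4-ne7b-p1 gen 41», `CLAIMS.log` l.27257; leaf-02's acknowledgement and FIXED NAMES l.27398): the
W-twin of this seat's `HistoryAssemblyRealiseRun` §3 (p211994) over leaf-03's IR-41-4 carrier file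
`HistoryRealiseWeakReading` (`RealisedReadingRW`, `termReadingLE_of_realisedRW`), itself over the owner's memory-agnostic
core `HistoryRealiseWeak` (`RealisesW`, p248661).

WHY.  The landed R7-a END `hybridNE7_of_realisedReadingR_canon` reads the live structures through `RealisedReadingR`,
whose geometric field `real` asks `Realises … ∧ PendingAt … K` — a predicate whose RENEWAL clause reads condition (ii)'s
memory FROZEN at the line's last event and demands a stop AT the renewal index (the owner's located MODEL findings
F-ne7bp1g40-1 and #3, R-OWNER-40-2 ∕ R-OWNER-41-1: print renews with the CURRENT level's parameters; B16 =
[Balaban1989LargeFieldII] pp. 383–384, B15 = [Balaban1989LargeFieldI] pp. 177, 198 — manuscripts UNDER AUDIT, locators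
only, nothing asserted).  Repair route R-41-a's design rule: the END must not depend on the readiness CONVENTION at all.
THIS FILE re-plugs the R7-a END over the memory-agnostic reading: hypothesis `RealisedReadingRW` (renewals ask only
condition (i) at the readiness index + frozen pendency before it, which EVERY convention with memory `≤ R t₀` meets),
proof = the landed proof with `termReadingLE_of_realisedR ↦ termReadingLE_of_realisedRW`; the conclusion is
BYTE-IDENTICAL.  §2 of the landed file (`runProfile`, `dropCtl_clampTail`, `dropCtl_runProfile`) is carrier-free and is
used BY NAME downstream (`HistoryAssemblyRealiseRunEndW`).  The landed R ∕ P ENDs stay; they follow from this one through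
`RealisedReadingR.toW` ∕ `RealisedReadingRP.toW` (leaf-03's file).  Append-only: nothing landed is edited.

WHAT.  **`hybridNE7_of_realisedReadingRW_canon`** (R7-a, W-carrier: `hdrop : ∀ K ≥ K₀, ∀ m, DropCtl (sP K) m` displayed).
[folklore] COMPOSITION BY NAME of landed theorems of the cell; NO definition, no hypothesis shape, no `Prop`-valued fact
of Bałaban's minted (trigger c1), nothing printed asserted, no `[cite:]` tag, zero `sorry`.

WHAT STAYS DISPLAYED (census, unchanged from the landed END but for the carrier): side conditions `4 ≤ F.L`,
`13 ≤ C.n₁`, `1 ≤ R K t`, drop control per cutoff; the reading map (`ped`, `cellP`, `liveC`, `cellOf`) with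
`RealisedReadingRW F.L sP …`; per-term price readings; `Regeneration` numerator fields; constants; flow side
(⇐ BetaPertH); tuning; `irThresholdTLE C F.L rr β₀ ≤ log g⁻²`; (2.5); (B); seams.

HONEST.  The reading H3^NE7b (that the live structures ARE weakly realised pending pedigrees with root cells), (B) and
the BetaPertH-flow facts stay DISPLAYED; by-name class of every `WALL-NE7b-P1.md` §2 binder UNCHANGED; headline p224237
UNCHANGED BY NAME (its W re-plug is file E8 of this list, not this file); located open point G-M4-1 untouched; NE7b NOT
proved; spine 0∕9.  HONEST DEPENDENCY (cell): continuum YM on T⁴ ⇐ BetaPertH ∧ nine spine estimates (0/9 proved);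
BetaPertH ⇐ (D1) ∧ (D4) ∧ CAP+tail; G-an2-4 gates asym, D1 and NE2/3/4.  This file changes none of it.
-/

open Finset MeasureTheory
open Literature.MathematicalPhysics.QuantumFieldTheory.Balaban1983to89
open T4PersistenceDictionary T4PersistentHistoryCount T4BankedInduction T4PrintedShapeBanking
open T4WeightBudget T4GlobalDenominator T4LiveClassFibration T4LiveStructureGas T4LiveGasToTerms T4RecordPriceSeam
open T4PartnerMultiplicity T4IndicatorShell T4MatchingAssembly T4MatchingClosure T4MatchingClosureSocket T4Continuum
open T4StabilitySocket T4BranchingRecordsGas T4TaggedShapeBanking T4CanonicalMenus T4RenewalChains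
open Summit.QuantumFields.BalabanUV.T4Continuum.PlacementBatch
open Summit.QuantumFields.BalabanUV.T4Continuum.PlacementSkeleton
open Summit.QuantumFields.BalabanUV.T4Continuum.CountThresholdUniform
open Summit.QuantumFields.BalabanUV.T4Continuum.CountThresholdExit
open Summit.QuantumFields.BalabanUV.T4Continuum.CountSeamJunction
open Summit.QuantumFields.BalabanUV.T4Continuum.LateMergers
open Summit.QuantumFields.BalabanUV.T4Continuum.HistoryFlow
open Summit.QuantumFields.BalabanUV.T4Continuum.HistoryRegeneration
open Summit.QuantumFields.BalabanUV.T4Continuum.HistoryTables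
open Summit.QuantumFields.BalabanUV.T4Continuum.HistoryAssemblyTrees
open Summit.QuantumFields.BalabanUV.T4Continuum.HistoryAssemblyTerms
open Summit.QuantumFields.BalabanUV.T4Continuum.HistoryAssemblyPedigree
open Summit.QuantumFields.BalabanUV.T4Continuum.HistoryConstants
open Summit.QuantumFields.BalabanUV.T4Continuum.HistoryGen
open Literature.MathematicalPhysics.QuantumFieldTheory.Balaban1983to89.B13ScaleTransfer
open Summit.QuantumFields.BalabanUV.T4Continuum.ZoneSkeleton
open Summit.QuantumFields.BalabanUV.T4Continuum.HistorySocketTH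
open Summit.QuantumFields.BalabanUV.T4Continuum.HistoryCaps
open Summit.QuantumFields.BalabanUV.T4Continuum.HistoryAssemblyPrice
open Summit.QuantumFields.BalabanUV.T4Continuum.HistoryBankingLE
open Summit.QuantumFields.BalabanUV.T4Continuum.HistoryTreeShapeLE
open Summit.QuantumFields.BalabanUV.T4Continuum.HistoryExitLE
open Summit.QuantumFields.BalabanUV.T4Continuum.HistoryAssemblyTermsLE
open Summit.QuantumFields.BalabanUV.T4Continuum.HistoryRealise
open Summit.QuantumFields.BalabanUV.T4Continuum.HistoryAssemblyRealiseLE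
open Summit.QuantumFields.BalabanUV.T4Continuum.HistoryAssemblyRealisePrice
open Summit.QuantumFields.BalabanUV.T4Continuum.HistoryZones
open Summit.QuantumFields.BalabanUV.T4Continuum.HistoryRealisePrint
open Summit.QuantumFields.BalabanUV.T4Continuum.HistoryRealiseWeak
open Summit.QuantumFields.BalabanUV.T4Continuum.HistoryAssemblyRealiseRun
open Summit.QuantumFields.BalabanUV.T4Continuum.HistoryRealisePrintReading
open Summit.QuantumFields.BalabanUV.T4Continuum.HistoryRealiseWeakReading

namespace Summit.QuantumFields.BalabanUV.T4Continuum.HistoryAssemblyRealiseRunW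

noncomputable section

/-! ## The R7-a END over the memory-agnostic per-cutoff reading -/

section End

variable {F : T4Family} {G : Type*} [GaugeGroup G] [MeasurableSpace G] [HaarData G] [RegularGaugeGroup G]
variable {α π : Type*} [DecidableEq α] [DecidableEq π] {dP : ℕ}
variable {ι : Type*} [DecidableEq ι] {l₀ vol : ℝ} {K₀ : ℕ} {T : ℕ → Finset ι} {A A' shA shB : ℕ → ℝ → ι → ℝ}
  {dead dead' : ℕ → ℝ → ι → ℝ} {nup mup : ℕ → ℝ → ℝ} {Nup : ℝ}
  {Cc Rr CcRec RrRec : ℕ → ℝ → ι → ℝ} {ν u s₂ q₀ r s Wsh : ℕ → ℝ}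

/-- **NE7b's COUNT EXIT WITH THE LIVE STRUCTURES READ AS WEAKLY (MEMORY-AGNOSTICALLY) REALISED PENDING PEDIGREES,
S-PROFILE PER CUTOFF** (R7-a, W-carrier).  `HistoryAssemblyRealiseRun.hybridNE7_of_realisedReadingR_canon` VERBATIM with
the reading `RealisedReadingRW F.L sP …` (`real := ∃ Z, RealisesW … ∧ PendingBefore … K`) in place of `RealisedReadingR`,
plugged through `termReadingLE_of_realisedRW`; every other binder and the conclusion byte-identical. [folklore] -/
theorem hybridNE7_of_realisedReadingRW_canon (D : FiniteEpsData F G) {C : T4PrintedShapeBanking.Consts}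
    {rr : ℕ} {β₀ : ℝ} (h : ThresholdOK C F.L rr β₀) (hμ : 0 < C.μ) (d n : ℕ)
    (hκ₁ : (d : ℝ) * Real.log F.L + 2 * Real.log 2 ≤ C.κ₁) (hE₀ : Real.log (2 + birthMass C) ≤ C.E₀)
    -- the flow side (⇐ BetaPertH, displayed) and tuning
    {γ₀ γb b β' : ℝ} {pe : ℕ} (hb : 0 ≤ b) (hlo : FlowStep.BetaLowerH b γ₀ D.βfun)
    (hhi : FlowStep.BetaUpperH β' γ₀ D.βfun) (hγ : γb ≤ γ₀) (hγβ : γb ^ 2 * β' < 1)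
    (S : B14FlowStep.SmallnessFor γb β' β₀ F.L pe) (hp₀ : C.p₀ ≤ pe) (hrr : rr ≤ pe)
    {g : ℝ} {g₀ : ℕ → ℝ} (ht : D.Tuned γb g g₀)
    (hir : irThresholdTLE C F.L rr β₀ ≤ Real.log (g ^ 2)⁻¹)
    -- the (B) side
    (hsign : B16.SignConventions D.C) {γB : ℝ} {em ep : ℝ → ℝ} (hcor : B16.Cor3With D.C γB em ep) (hγB : γb ≤ γB)
    {obs : (K : ℕ) → GaugeField (F.P K) 0 G → ℝ} {B : ℝ}
    (hobs : ∀ K, Measurable (obs K)) (hbd : ∀ K U, |obs K U| ≤ B)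
    (hα : ∀ K t, |t| ≤ l₀ → K₀ ≤ K →
      ∫ U, Real.exp (t * obs K U) * D.dens K (g₀ K) 0 U ∂fieldMeasure (F.P K) 0 G ≤ ∑ τ ∈ T K, A K t τ)
    (hα' : ∀ K t, |t| ≤ l₀ → K₀ ≤ K →
      ∫ U, Real.exp (t * obs (K + 1) U) * D.dens (K + 1) (g₀ (K + 1)) 0 U ∂fieldMeasure (F.P (K + 1)) 0 G ≤
        ∑ τ ∈ T K, A' K t τ)
    {c₀ n₁ : ℝ} (hc₀ : 0 < c₀) (hfloor : ∀ K, K₀ ≤ K → c₀ ≤ smallFieldMass D K (g₀ K))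
    (hfloor' : ∀ K, K₀ ≤ K → c₀ ≤ smallFieldMass D (K + 1) (g₀ (K + 1)))
    (hsites : ∀ K, K₀ ≤ K → ((D.C ⟨K, F.m, g₀ K⟩).numSites K : ℝ) ≤ n₁)
    (hsites' : ∀ K, K₀ ≤ K → ((D.C ⟨K + 1, F.m, g₀ (K + 1)⟩).numSites (K + 1) : ℝ) ≤ n₁)
    (hNup : 0 ≤ Nup) (hnup : ∀ K t, |t| ≤ l₀ → K₀ ≤ K → 0 ≤ nup K t ∧ nup K t ≤ Nup)
    (hmup : ∀ K t, |t| ≤ l₀ → K₀ ≤ K → 0 ≤ mup K t ∧ mup K t ≤ Nup)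
    -- the (2.5) side condition on the size function
    (R : ℕ → ℕ → ℕ) (hR : ∀ K s, s ≤ K → B14.IsRj F.L rr ((D.C ⟨K, F.m, g₀ K⟩).flow.g s) (R K s))
    -- the side conditions of the geometric lemmas (row S1b): torus side, drop control PER CUTOFF, window constant, sizes
    {sP : ℕ → ℕ → ℕ} (hL4 : 4 ≤ F.L) (hdrop : ∀ K, K₀ ≤ K → ∀ m, B16SProfile.DropCtl (sP K) m) (hn₁ : 13 ≤ C.n₁)
    (hR1 : ∀ K, K₀ ≤ K → ∀ t, 1 ≤ R K t)
    -- H3: the terms read as REALISED PENDING PEDIGREES of live components with root cells, profile per cutoff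
    (ped : ℕ → ι → Pedigree α π) (cellP : ℕ → ι → π → Pt dP × Finset (Pt dP)) (liveC : ℕ → ι → Finset α)
    (cellOf : ℕ → ι → α → (Fin d → ℕ))
    (H : RealisedReadingRW F.L sP (cellN d n F.L) K₀ R T ped cellP liveC cellOf)
    {Fc Rf Fc' Rf' : ℕ → Finset (BSlot (Fin d → ℕ) PEv) → ℝ}
    (hprice : ∀ K t, |t| ≤ l₀ → K₀ ≤ K → ∀ τ ∈ badTerms (memOf ped liveC cellOf) jhalf T K,
      Fc K (bstrOf Prod.fst (memOf ped liveC cellOf) K τ) * Rf K (bstrOf Prod.fst (memOf ped liveC cellOf) K τ) ≤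
        ∏ q ∈ memOf ped liveC cellOf K τ,
          priceT Prod.fst C ((F.L : ℝ) ^ d) R (fun K => (D.C ⟨K, F.m, g₀ K⟩).flow.g) K q)
    (hprice' : ∀ K t, |t| ≤ l₀ → K₀ ≤ K → ∀ τ ∈ badTerms (memOf ped liveC cellOf) jhalf T K,
      Fc' K (bstrOf Prod.fst (memOf ped liveC cellOf) K τ) * Rf' K (bstrOf Prod.fst (memOf ped liveC cellOf) K τ) ≤
        ∏ q ∈ memOf ped liveC cellOf K τ,
          priceT Prod.fst C ((F.L : ℝ) ^ d) R (fun K => (D.C ⟨K, F.m, g₀ K⟩).flow.g) K q)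
    -- H3: the remaining `Regeneration` numerator readings, over the classes of the terms
    (up : ∀ K t, |t| ≤ l₀ → K₀ ≤ K → ∀ c ∈ badClasses Prod.fst (memOf ped liveC cellOf) jhalf T K,
      ∀ τ ∈ fibre (bstrOf Prod.fst (memOf ped liveC cellOf)) T K c, A K t τ ≤ dead K t τ * Fc K c * nup K t)
    (dead_nonneg : ∀ K t, |t| ≤ l₀ → K₀ ≤ K → ∀ c ∈ badClasses Prod.fst (memOf ped liveC cellOf) jhalf T K,
      ∀ τ ∈ fibre (bstrOf Prod.fst (memOf ped liveC cellOf)) T K c, 0 ≤ dead K t τ)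
    (resum : ∀ K t, |t| ≤ l₀ → K₀ ≤ K → ∀ c ∈ badClasses Prod.fst (memOf ped liveC cellOf) jhalf T K,
      ∑ τ ∈ fibre (bstrOf Prod.fst (memOf ped liveC cellOf)) T K c, dead K t τ ≤ Rf K c)
    (F_nonneg : ∀ K t, |t| ≤ l₀ → K₀ ≤ K → ∀ c ∈ badClasses Prod.fst (memOf ped liveC cellOf) jhalf T K, 0 ≤ Fc K c)
    (up' : ∀ K t, |t| ≤ l₀ → K₀ ≤ K → ∀ c ∈ badClasses Prod.fst (memOf ped liveC cellOf) jhalf T K,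
      ∀ τ ∈ fibre (bstrOf Prod.fst (memOf ped liveC cellOf)) T K c, A' K t τ ≤ dead' K t τ * Fc' K c * mup K t)
    (dead'_nonneg : ∀ K t, |t| ≤ l₀ → K₀ ≤ K → ∀ c ∈ badClasses Prod.fst (memOf ped liveC cellOf) jhalf T K,
      ∀ τ ∈ fibre (bstrOf Prod.fst (memOf ped liveC cellOf)) T K c, 0 ≤ dead' K t τ)
    (resum' : ∀ K t, |t| ≤ l₀ → K₀ ≤ K → ∀ c ∈ badClasses Prod.fst (memOf ped liveC cellOf) jhalf T K,
      ∑ τ ∈ fibre (bstrOf Prod.fst (memOf ped liveC cellOf)) T K c, dead' K t τ ≤ Rf' K c)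
    (F'_nonneg : ∀ K t, |t| ≤ l₀ → K₀ ≤ K → ∀ c ∈ badClasses Prod.fst (memOf ped liveC cellOf) jhalf T K,
      0 ≤ Fc' K c)
    -- the seam's other inputs
    (hSh : ShellWeightBound l₀ T A A' shA shB Wsh)
    (hTB : ReindexedBudget l₀ vol T (fun K t τ => A K t τ - shA K t τ) (fun K t τ => A' K t τ - shB K t τ)
      (badOfClass (bstrOf Prod.fst (memOf ped liveC cellOf)) T
        (fun K _ => badClasses Prod.fst (memOf ped liveC cellOf) jhalf T K)) Cc Rr CcRec RrRec ν u s₂ q₀ r s)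
    (hr : Summable r) (hu : Summable u) (hs : Summable s) (hs₂ : Summable s₂) :
    ∃ K₁ K₂, K₀ ≤ K₁ ∧ HybridNE7 l₀ vol (fun K => T (K₁ + (K₂ + K))) (fun K => A (K₁ + (K₂ + K)))
      (fun K => A' (K₁ + (K₂ + K)))
      (fun K => badOfClass (bstrOf Prod.fst (memOf ped liveC cellOf)) T
        (fun K _ => badClasses Prod.fst (memOf ped liveC cellOf) jhalf T K) (K₁ + (K₂ + K)))
      (fun K => constOf l₀ B (max (em g) 0) n₁ c₀ Nup *
        recordsBudget (birthMass C) C.κ₁ ((n : ℝ) ^ d) ((F.L : ℝ) ^ d) (Real.log 2) jhalf (K₁ + (K₂ + K)))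
      (fun K => shA (K₁ + (K₂ + K))) (fun K => shB (K₁ + (K₂ + K))) (fun K => Wsh (K₁ + (K₂ + K)))
      (fun K => (r (K₁ + (K₂ + K)) + u (K₁ + (K₂ + K))) + (s (K₁ + (K₂ + K)) + s₂ (K₁ + (K₂ + K)))) :=
  hybridNE7_of_termReadingLE_canon D Prod.fst h hμ d n (dcapOf Prod.fst T (memOf ped liveC cellOf))
    (ncapOf T (memOf ped liveC cellOf)) hκ₁ hE₀ hb hlo hhi hγ hγβ S hp₀ hrr ht hir hsign hcor hγB hobs hbd hα hα' hc₀
    hfloor hfloor' hsites hsites' hNup hnup hmup R hR (memOf ped liveC cellOf)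
    (termReadingLE_of_realisedRW hL4 hdrop hn₁ hR1 H jhalf) hprice hprice' up dead_nonneg resum F_nonneg up'
    dead'_nonneg resum' F'_nonneg hSh hTB hr hu hs hs₂

end End

end

end Summit.QuantumFields.BalabanUV.T4Continuum.HistoryAssemblyRealiseRunW
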